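import Mathlib
import Summits.NavierStokesRegularity.NavierStokesRegularity.Theses.LandauTail

/-!
# NavierStokesRegularity — route `LandauTail`, support `TailForcesBlowup`

Settles `stmt-NavierStokesRegularity-1950` (positive): a Landau tail at `(xs, T)` forbids a
smooth extension past `T`, so the Landau-tailed classical Leray–Hopf solution of the route's
thesis `LandauTailBlowup` is a maximal smooth solution with lifespan `T`, i.e. the hypothesis
`X5a = Blowup.BlowupExists` (`stmt-NavierStokesRegularity-0152` verbatim) of the proved glue
`Literature.NS.blowup_assembly`.

Proof. Keep the same `(ν, T, u, p)`; `IsMaximalSmoothSolution ν 0 u p T` needs only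
`¬ HasSmoothExtensionPast ν 0 u T`. If `(u', p')` is classical on `[0, T')`, `T' > T`, with
`u' = u` on `[0, T)`, then `uncurry u'` is continuous at `(T, xs)` within `[0, T') × ℝ³`
(joint smoothness, `IsClassicalNSSolutionOn.smooth_velocity`). Pick `x₀` with `U x₀ ≠ 0`
(a conjunct of the profile class); `x₀ ≠ 0` because `(-1)`-homogeneity forces `U 0 = 0`.
Along the curve `t ↦ (t, xs + √(T - t) • x₀)`, which tends to `(T, xs)` inside
`[0, T') × ℝ³` as `t → T⁻`, we get `u t (xs + √(T - t) • x₀) = u' t (…) → u' T xs`, hence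
`√(T - t) • u t (…) → 0 • u' T xs = 0`; uniqueness of limits in `ℝ³` against the tail
hypothesis (limit `U x₀ ≠ 0`) is the contradiction. Elementary topology only
(Beale–Kato–Majda 1984, §1 for the continuation vocabulary).
-/

open Filter Set Topology

namespace Summit.NavierStokesRegularity.NavierStokesRegularity.Theorems

/-- A `(-1)`-homogeneous vector field on `ℝ³` (`U (c • x) = c⁻¹ • U x` for `c > 0`, with the
value at the origin included in the identity) vanishes at the origin: `U 0 = 2⁻¹ • U 0`.
[folklore] -/
theorem landauTail_homogeneous_apply_zero
    {U : EuclideanSpace ℝ (Fin 3) → EuclideanSpace ℝ (Fin 3)}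
    (hhom : ∀ c : ℝ, 0 < c → ∀ x : EuclideanSpace ℝ (Fin 3), U (c • x) = c⁻¹ • U x) :
    U 0 = 0 := by
  have h : U 0 = (2 : ℝ)⁻¹ • U 0 := by simpa using hhom 2 two_pos 0
  have key : ((1 : ℝ) - 2⁻¹) • U 0 = 0 := by
    rw [sub_smul, one_smul, ← h, sub_self]
  exact (smul_eq_zero.mp key).resolve_left (by norm_num)

/-- **A Landau tail forces blow-up** (no smooth continuation). If a classical solution `u` on
`[0, T)` has, at some point `xs`, a nonzero parabolic-scale limit
`√(T - t) • u t (xs + √(T - t) • y) → V` (`t → T⁻`) for some `y`, then `u` admits no classical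
extension past `T`: an extension `u'` is jointly continuous at `(T, xs)`, so along the curve
`t ↦ xs + √(T - t) • y` the values `u t = u' t` stay bounded (tend to `u' T xs`) and the
rescaled values tend to `0 ≠ V`. [folklore] -/
theorem landauTail_not_hasSmoothExtensionPast_of_scaledLimit
    {ν T : ℝ} (hT : 0 < T)
    {u : ℝ → EuclideanSpace ℝ (Fin 3) → EuclideanSpace ℝ (Fin 3)}
    {xs y V : EuclideanSpace ℝ (Fin 3)} (hV : V ≠ 0)
    (htail : Tendsto (fun t : ℝ => Real.sqrt (T - t) • u t (xs + Real.sqrt (T - t) • y))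
      (𝓝[<] T) (𝓝 V)) :
    ¬ Literature.Analysis.FluidPDE.HasSmoothExtensionPast ν 0 u T := by
  rintro ⟨T', hT', u', p', hcl', heq⟩
  -- `√(T - t) → 0` as `t → T⁻`
  have hsqrt : Tendsto (fun t : ℝ => Real.sqrt (T - t)) (𝓝[<] T) (𝓝 0) := by
    have hc : Continuous fun t : ℝ => Real.sqrt (T - t) :=
      (continuous_const.sub continuous_id).sqrt
    have := hc.tendsto T
    rw [sub_self, Real.sqrt_zero] at this
    exact this.mono_left nhdsWithin_le_nhds
  -- times `t ∈ [0, T)` are eventually all of `t → T⁻`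
  have hmem : ∀ᶠ t in 𝓝[<] T, t ∈ Ico 0 T := Ico_mem_nhdsLT hT
  -- the extension is jointly continuous at `(T, xs)` within `[0, T') × ℝ³`
  have hcont : ContinuousWithinAt (Function.uncurry u') (Ico 0 T' ×ˢ univ) (T, xs) :=
    (ContDiffOn.continuousOn hcl'.smooth_velocity) (T, xs) ⟨⟨hT.le, hT'⟩, mem_univ _⟩
  -- the curve `t ↦ (t, xs + √(T - t) • y)` tends to `(T, xs)` inside `[0, T') × ℝ³`
  have hcurve : Tendsto (fun t : ℝ => ((t, xs + Real.sqrt (T - t) • y) : ℝ × EuclideanSpace ℝ (Fin 3)))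
      (𝓝[<] T) (𝓝[Ico 0 T' ×ˢ univ] (T, xs)) := by
    refine tendsto_nhdsWithin_iff.mpr ⟨?_, ?_⟩
    · have ha : Tendsto (fun t : ℝ => t) (𝓝[<] T) (𝓝 T) :=
        tendsto_id.mono_left nhdsWithin_le_nhds
      have hb : Tendsto (fun t : ℝ => xs + Real.sqrt (T - t) • y) (𝓝[<] T) (𝓝 xs) := by
        have := (hsqrt.smul_const y).const_add xs
        simpa using this
      exact ha.prodMk_nhds hb
    · filter_upwards [hmem] with t ht
      exact ⟨⟨ht.1, ht.2.trans hT'⟩, mem_univ _⟩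
  have h2 : Tendsto (fun t : ℝ => u' t (xs + Real.sqrt (T - t) • y)) (𝓝[<] T) (𝓝 (u' T xs)) :=
    hcont.tendsto.comp hcurve
  -- transfer to `u` (equal to `u'` on `[0, T)`)
  have h3 : Tendsto (fun t : ℝ => u t (xs + Real.sqrt (T - t) • y)) (𝓝[<] T) (𝓝 (u' T xs)) := by
    refine h2.congr' ?_
    filter_upwards [hmem] with t ht
    rw [heq t ht]
  have h4 : Tendsto (fun t : ℝ => Real.sqrt (T - t) • u t (xs + Real.sqrt (T - t) • y))
      (𝓝[<] T) (𝓝 ((0 : ℝ) • u' T xs)) :=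
    hsqrt.smul h3
  rw [zero_smul] at h4
  exact hV (tendsto_nhds_unique htail h4)

/-- Settles stmt-NavierStokesRegularity-1950 (`TailForcesBlowup`, route `LandauTail`): the glue
`X → X5a` — a classical Leray–Hopf solution from a rapidly decaying datum with a Landau tail at
`(xs, T)` (parabolic-scale convergence to a nonzero `(-1)`-homogeneous steady profile `U` off the
origin) is a maximal smooth solution with lifespan `T` (`IsMaximalSmoothSolution ν 0 u p T`),
Leray–Hopf from the same rapidly decaying datum. The witness is the same `(ν, T, u, p)`;
maximality is `landauTail_not_hasSmoothExtensionPast_of_scaledLimit` at a point `x₀ ≠ 0` with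
`U x₀ ≠ 0` (exists: `U` is nonzero somewhere and `U 0 = 0` by homogeneity). [folklore] -/
theorem tailForcesBlowup_proof :
    Summit.NavierStokesRegularity.NavierStokesRegularity.Theses.LandauTail.TailForcesBlowup := by
  unfold Summit.NavierStokesRegularity.NavierStokesRegularity.Theses.LandauTail.TailForcesBlowup
  rintro ⟨ν, hν, T, hT, u, p, hcl, hLH, hdec, xs, U, P, ⟨-, -, -, -, hhom, x₀, hx₀⟩, htail⟩
  have hx₀ne : x₀ ≠ 0 := by
    rintro rfl
    exact hx₀ (landauTail_homogeneous_apply_zero hhom)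
  exact ⟨ν, hν, T, hT, u, p,
    ⟨hcl, landauTail_not_hasSmoothExtensionPast_of_scaledLimit hT hx₀ (htail x₀ hx₀ne)⟩, hLH, hdec⟩

end Summit.NavierStokesRegularity.NavierStokesRegularity.Theorems
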